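import Mathlib
import Summits.Ventures.PercRepro2.Defs
import Summits.Ventures.PercRepro2.Independence
import Summits.Ventures.PercRepro2.Harris
import Summits.Ventures.PercRepro2.CoinDefs
import Summits.Ventures.PercRepro2.CoinArcsOff
import Summits.Ventures.PercRepro2.CoinPendantDefs
import Summits.Ventures.PercRepro2.CoinPendant
import Summits.Ventures.PercRepro2.CoinInduced
import Summits.Ventures.PercRepro2.CoinVdBK
import Summits.Ventures.PercRepro2.CoinBHK
import Summits.Ventures.PercRepro2.CoinReverse
import Summits.Ventures.PercRepro2.CoinLemmaA
import Summits.Ventures.PercRepro2.CoinDarcMixed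
import Summits.Ventures.PercRepro2.CoinTwoPendantDefs
import Summits.Ventures.PercRepro2.CoinTwoPendantMass
import Summits.Ventures.PercRepro2.CoinTraceLevels
import Summits.Ventures.PercRepro2.CoinTraceReduce
import Summits.Ventures.PercRepro2.CoinFunctionalDefs

/-!
# The general pendant-head reduction in FUNCTIONAL form (blind cell PercRepro2, night-2 g3;
proofs/NIGHT2-DARC.md §22.1)

`darcF_of_trace_functional`: `darc_of_trace_functional` for increasing `[0, 1]`-valued cluster
functionals `F₁, F₂` that are BLIND to the pendant set (`F (S ∖ (P ∪ {t})) = F S`): on `R_T` the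
cluster outside `P ∪ {t}` is the `D₀`-cluster, the `D₀`-functionals depend on the non-pendant
coins, and the inner covariances are `covF_nonneg`.  With it every abstract-lemma instance of the
sign method gives the functional form of its head theorem (`CoinFunctionalAPL.lean`).
-/

namespace Summit.Ventures.PercRepro2.Coin

section ReduceF

open Classical

variable {V : Type*} {E : Type*} [Fintype V] [DecidableEq V] [Fintype E] [DecidableEq E]
  {R : Type*} [Field R] [LinearOrder R] [IsStrictOrderedRing R]

/-- **Row 2′DARC in functional form at a general pendant head, modulo the sign of the trace
functional**: `F₁, F₂` increasing, `[0, 1]`-valued, blind to `P ∪ {t}`. -/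
theorem darcF_of_trace_functional (p : E → R) (hp : IsProbVec p) {arcs : E → Finset (V × V)}
    (hS : SameEnds arcs) {P : Finset V} {t : V} (hclosed : ClosedOut arcs P {t})
    (hT : TailCoinsIn arcs P {t}) (s u w : V) (hw : w ∈ P) {F₁ F₂ : Set V → R}
    (hF₁ : Monotone F₁) (hF₂ : Monotone F₂) (hF₁0 : ∀ S, 0 ≤ F₁ S) (hF₂0 : ∀ S, 0 ≤ F₂ S)
    (hF₁b : ∀ S : Set V, F₁ (S \ ↑(P ∪ {t})) = F₁ S)
    (hF₂b : ∀ S : Set V, F₂ (S \ ↑(P ∪ {t})) = F₂ S) (hu : u ∉ P ∪ {t})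
    (hQ : ∀ Z ∈ P.powerset,
      0 < prob p (avoidEvent (arcsOff arcs (P ∪ {t})) s (gateTarget u w Z {t})))
    (hS' : 0 ≤ ∑ Z ∈ P.powerset,
      prob p (traceLevel arcs {t} P Z) *
        prob p (avoidEvent (arcsOff arcs (P ∪ {t})) s (gateTarget u w Z {t})) *
        (massE p (fun ω => F₁ (clusterC (arcsOff arcs (P ∪ {t})) ω s))
            (avoidEvent (arcsOff arcs (P ∪ {t})) s (gateTarget u w Z {t})) /
          prob p (avoidEvent (arcsOff arcs (P ∪ {t})) s (gateTarget u w Z {t})) *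
          (∑ Z' ∈ P.powerset, prob p (traceLevel arcs {t} P Z') *
            prob p (avoidEvent (arcsOff arcs (P ∪ {t})) s (Z' ∪ {t})))
          - ∑ Z' ∈ P.powerset, prob p (traceLevel arcs {t} P Z') *
            massE p (fun ω => F₁ (clusterC (arcsOff arcs (P ∪ {t})) ω s))
              (avoidEvent (arcsOff arcs (P ∪ {t})) s (Z' ∪ {t}))) *
        (massE p (fun ω => F₂ (clusterC (arcsOff arcs (P ∪ {t})) ω s))
            (avoidEvent (arcsOff arcs (P ∪ {t})) s (gateTarget u w Z {t})) /
          prob p (avoidEvent (arcsOff arcs (P ∪ {t})) s (gateTarget u w Z {t})) *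
          (∑ Z' ∈ P.powerset, prob p (traceLevel arcs {t} P Z') *
            prob p (avoidEvent (arcsOff arcs (P ∪ {t})) s (Z' ∪ {t})))
          - ∑ Z' ∈ P.powerset, prob p (traceLevel arcs {t} P Z') *
            massE p (fun ω => F₂ (clusterC (arcsOff arcs (P ∪ {t})) ω s))
              (avoidEvent (arcsOff arcs (P ∪ {t})) s (Z' ∪ {t})))) :
    DARCF p arcs s {t} F₁ F₂ u w := by
  have hS₀ : SameEnds (arcsOff arcs (P ∪ {t})) := sameEnds_arcsOff hS _
  set D₀ := arcsOff arcs (P ∪ {t}) with hD₀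
  set X₀ : Config E → R := fun ω => F₁ (clusterC D₀ ω s) with hX₀
  set Y₀ : Config E → R := fun ω => F₂ (clusterC D₀ ω s) with hY₀
  -- the markers on `R_T` are the reduced markers
  have hcl : ∀ ω ω' : Config E, (∀ e ∈ (tailCoins arcs P)ᶜ, ω e = ω' e) →
      clusterC D₀ ω s = clusterC D₀ ω' s := by
    intro ω ω' h
    have hcongr : ∀ e, arcsOff arcs (P ∪ {t}) e ≠ ∅ → ω e = ω' e := by
      intro e he
      by_cases hmem : e ∈ tailCoins arcs P
      · exact absurd (arcsOff_eq_empty_of_tailCoins hT hmem) he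
      · exact h e hmem
    ext v
    simp only [clusterC, Set.mem_setOf_eq]
    exact reach_arcsOff_congr hcongr
  have hdepX : DependsOn X₀ (tailCoins arcs P)ᶜ := fun ω ω' h => by
    show F₁ (clusterC D₀ ω s) = F₁ (clusterC D₀ ω' s)
    rw [hcl ω ω' h]
  have hdepY : DependsOn Y₀ (tailCoins arcs P)ᶜ := fun ω ω' h => by
    show F₂ (clusterC D₀ ω s) = F₂ (clusterC D₀ ω' s)
    rw [hcl ω ω' h]
  have hdepXY : DependsOn (fun ω => X₀ ω * Y₀ ω) (tailCoins arcs P)ᶜ := fun ω ω' h => by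
    show X₀ ω * Y₀ ω = X₀ ω' * Y₀ ω'
    rw [hdepX h, hdepY h]
  have hdep1 : DependsOn (fun _ : Config E => (1 : R)) (tailCoins arcs P)ᶜ := fun _ _ _ => rfl
  have hcls : ∀ ω ∈ avoidEvent arcs s {t},
      clusterC arcs ω s \ ↑(P ∪ {t}) = clusterC D₀ ω s \ ↑(P ∪ {t}) := by
    intro ω hω
    ext v
    simp only [Set.mem_sdiff, clusterC, Set.mem_setOf_eq, Finset.mem_coe]
    constructor
    · rintro ⟨hr, hv⟩
      exact ⟨(reach_iff_trace hclosed hω hv).mp hr, hv⟩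
    · rintro ⟨hr, hv⟩
      exact ⟨(reach_iff_trace hclosed hω hv).mpr hr, hv⟩
  have hmX : ∀ ω ∈ avoidEvent arcs s {t}, F₁ (clusterC arcs ω s) = X₀ ω := by
    intro ω hω
    show F₁ (clusterC arcs ω s) = F₁ (clusterC D₀ ω s)
    rw [← hF₁b, hcls ω hω, hF₁b]
  have hmY : ∀ ω ∈ avoidEvent arcs s {t}, F₂ (clusterC arcs ω s) = Y₀ ω := by
    intro ω hω
    show F₂ (clusterC arcs ω s) = F₂ (clusterC D₀ ω s)
    rw [← hF₂b, hcls ω hω, hF₂b]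
  have hmXY : ∀ ω ∈ avoidEvent arcs s {t},
      F₁ (clusterC arcs ω s) * F₂ (clusterC arcs ω s) = X₀ ω * Y₀ ω :=
    fun ω hω => by rw [hmX ω hω, hmY ω hω]
  have eX := trace_mass p hclosed hT s hu hw hdepX hmX
  have eY := trace_mass p hclosed hT s hu hw hdepY hmY
  have eXY := trace_mass p hclosed hT s hu hw hdepXY hmXY
  have e1 := trace_mass p hclosed hT s hu hw hdep1 (fun _ _ => rfl)
  simp only [← prob_eq_massE_one] at e1
  unfold DARCF phiF
  simp only []
  rw [e1.1, eX.1, eY.1, e1.2, eX.2, eY.2, eXY.2]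
  -- the per-trace identity: `Λ²·ℓ Ĉ − Λ MX ℓ B̂ − Λ MY ℓ Â + MX MY ℓ Q̂ = Λ² ℓ (Ĉ − ÂB̂/Q̂) + ℓ Q̂ (x̂Λ − MX)(ŷΛ − MY)`
  obtain ⟨Λ, hΛ⟩ : ∃ L : R, L = ∑ Z ∈ P.powerset, prob p (traceLevel arcs {t} P Z) *
      prob p (avoidEvent D₀ s (Z ∪ {t})) := ⟨_, rfl⟩
  obtain ⟨MX, hMX⟩ : ∃ M : R, M = ∑ Z ∈ P.powerset, prob p (traceLevel arcs {t} P Z) *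
      massE p X₀ (avoidEvent D₀ s (Z ∪ {t})) := ⟨_, rfl⟩
  obtain ⟨MY, hMY⟩ : ∃ M : R, M = ∑ Z ∈ P.powerset, prob p (traceLevel arcs {t} P Z) *
      massE p Y₀ (avoidEvent D₀ s (Z ∪ {t})) := ⟨_, rfl⟩
  rw [← hΛ, ← hMX, ← hMY] at hS' ⊢
  have hcov : 0 ≤ ∑ Z ∈ P.powerset, Λ ^ 2 * (prob p (traceLevel arcs {t} P Z) *
      (massE p (fun ω => X₀ ω * Y₀ ω) (avoidEvent D₀ s (gateTarget u w Z {t}))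
        - massE p X₀ (avoidEvent D₀ s (gateTarget u w Z {t})) *
          massE p Y₀ (avoidEvent D₀ s (gateTarget u w Z {t})) /
          prob p (avoidEvent D₀ s (gateTarget u w Z {t})))) := by
    refine Finset.sum_nonneg fun Z hZ => ?_
    have hq := hQ Z hZ
    have hc := covF_nonneg p hp hS₀ s hF₁ hF₂ hF₁0 hF₂0 (gateTarget u w Z {t})
    refine mul_nonneg (sq_nonneg _) (mul_nonneg (prob_nonneg hp _) ?_)
    rw [sub_nonneg, div_le_iff₀ hq]
    exact hc
  have key : Λ ^ 2 * ∑ Z ∈ P.powerset, prob p (traceLevel arcs {t} P Z) *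
        massE p (fun ω => X₀ ω * Y₀ ω) (avoidEvent D₀ s (gateTarget u w Z {t}))
      - Λ * MX * ∑ Z ∈ P.powerset, prob p (traceLevel arcs {t} P Z) *
        massE p Y₀ (avoidEvent D₀ s (gateTarget u w Z {t}))
      - Λ * MY * ∑ Z ∈ P.powerset, prob p (traceLevel arcs {t} P Z) *
        massE p X₀ (avoidEvent D₀ s (gateTarget u w Z {t}))
      + MX * MY * ∑ Z ∈ P.powerset, prob p (traceLevel arcs {t} P Z) *
        prob p (avoidEvent D₀ s (gateTarget u w Z {t}))
      = (∑ Z ∈ P.powerset, Λ ^ 2 * (prob p (traceLevel arcs {t} P Z) *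
          (massE p (fun ω => X₀ ω * Y₀ ω) (avoidEvent D₀ s (gateTarget u w Z {t}))
            - massE p X₀ (avoidEvent D₀ s (gateTarget u w Z {t})) *
              massE p Y₀ (avoidEvent D₀ s (gateTarget u w Z {t})) /
              prob p (avoidEvent D₀ s (gateTarget u w Z {t})))))
        + ∑ Z ∈ P.powerset, prob p (traceLevel arcs {t} P Z) *
          prob p (avoidEvent D₀ s (gateTarget u w Z {t})) *
          (massE p X₀ (avoidEvent D₀ s (gateTarget u w Z {t})) /
            prob p (avoidEvent D₀ s (gateTarget u w Z {t})) * Λ - MX) *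
          (massE p Y₀ (avoidEvent D₀ s (gateTarget u w Z {t})) /
            prob p (avoidEvent D₀ s (gateTarget u w Z {t})) * Λ - MY) := by
    rw [Finset.mul_sum, Finset.mul_sum, Finset.mul_sum, Finset.mul_sum, ← Finset.sum_sub_distrib,
      ← Finset.sum_sub_distrib, ← Finset.sum_add_distrib, ← Finset.sum_add_distrib]
    refine Finset.sum_congr rfl fun Z hZ => ?_
    have hq := (hQ Z hZ).ne'
    field_simp
    ring
  rw [key]
  exact add_nonneg hcov hS'

end ReduceF

end Summit.Ventures.PercRepro2.Coin
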